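import Literature.MathematicalPhysics.QuantumFieldTheory.Balaban1983to89.B13CovarianceDifference216
import Literature.MathematicalPhysics.QuantumFieldTheory.Balaban1983to89.B13Bound226Located
import Literature.MathematicalPhysics.QuantumFieldTheory.Balaban1983to89.B13Lemma3TorusPrimitive
import Mathlib.LinearAlgebra.Matrix.Gershgorin
import Summits.QuantumFields.BalabanUV.Gaps.D4WalkModelParametrix
import Summits.QuantumFields.BalabanUV.T4Continuum.Spine.NE5.TwoRunTorusWalkParam

/-!
# Spine/NE5/TwoRunTorusWalkParametrix — T25's σ-holomorphy input DISCHARGED for records whose Γ-kernel is a GLUED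
# family `S(σ,u)(1 − R(σ,u))⁻¹` of two (1.11)-shape domain families — NODE O's PARAMETRIX model included
# (cell `pub-balaban-gaps`, seat `ne5` gen 10)

WHY.  T25 `TwoRunTorusWalkParam.hol_and_h226_torus_of_termWalkData_param` delivers both torus-chain inputs for one term
along any parameter from ONE `B13TermWalkData` record at `c⁺`, leaving as input (i) the entrywise σ-holomorphy
`hAhol ∕ hGhol` of the record's kernels on the open `e^{κ₁+1}`-polydisc; T27 discharged (i) for LOCAL-family records
(NODE O's FULL model).  NODE O's PARAMETRIX model (g1-p2's `Gaps.D4WalkModelParametrix`; along NE5's pencil T18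
`TwoRunPencilParametrix.pencilTerm`) has precision `A2 ≡ 1` and Γ-kernel the GLUED family of [B9] (3.87)–(3.90),
`S(σ,u)·(1 − R(σ,u))⁻¹` reindexed, with SEED `S = Σ_□(∏σ)h_□G′_□(u)h_□` and STEP `R = Σ_□(∏σ)K(h_□)(u)G′_□(u)h_□` both
(3.107)-shape DOMAIN families (`B13DomainKernelWalks.DomainTerms`), polynomial in σ.  §1: domain-family kernels are ENTIRE
in σ; `S·(1 − R)⁻¹` is holomorphic in σ wherever `det(1 − R) ≠ 0` (r10's `differentiableOn_matrix_inv`).  §2: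
`hol_and_h226_torus_of_gluedKernels_param` = T25 with `hAhol ∕ hGhol` REPLACED by «`A2 σ b = A₀ b`, `G2 σ b =
(S.kernel σ b·(1 − R.kernel σ b)⁻¹).submatrix fΛ gN`» + ONE located letter `hdet : det(1 − R(σ,b)) ≠ 0` on the open
polydisc × α-ball.  §3: `ParametrixModelTerm.toKernels` HAS this shape (`rfl`), and its NODE-A inputs `hAs ∕ hA` are FREE
(`A2 ≡ 1`).  §4: `hdet` from an entrywise row-sum bound `Σ_j ‖R i j‖ < 1` (Gershgorin, Mathlib
`det_ne_zero_of_sum_row_lt_diag`).  §5: `hdet` BY NAME from a `WalkMajorants` family of `R`, and for the parametrix STEP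
family from its PRIMITIVE letters — exactly the hypotheses of g1-p2's `termWalkData_parametrix` — plus ONE smallness
`K̄_R·m·(1+2∕κ)^ν < 1` (`hdet_parametrix_step`; print: `λ_K = O(M⁻¹)`, [B9] (3.89)).  NET: for BOTH NODE O model families
the per-term residual of gate (c) is (iii)–(vi) of `HOME/ne/NE5.md` §15 (+ symmetry for the full model only).

HONEST FRAMING.  Pure composition of LANDED shapes (T25; r10's `differentiableOn_matrix_inv`; g1-p2's `ParametrixModelTerm`,
`isDomainLocalB_step`; Mathlib's Gershgorin lemma); every record, region, function and number is a HYPOTHESIS; nothing of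
Bałaban's `C^{(k)}(Z₀,σ)`, `Γ_k(Z₀,σ)`, `𝐕_k`, `G′_□`, `K′` is constructed; a MODEL-family feature exactly as T27's
(g1-plan-1 GEN 22 lens): Bałaban's local inverses `G′_□` are themselves infinite walk series ((v)⁺ is NODE O's statement).
NE5 NOT PRINTED ∕ NOT PROVED; leaves 0∕12; (D4) 0∕1; spine 0∕9; FIXED finite T⁴ — NOT continuum ∕ mass gap ∕ Clay.  0 sorry.

Sources: [II] = T. Bałaban, CMP **116** (1988) [Balaban1988RG2Cluster] (1.11) p. 5, p. 13, p. 15, (2.14)–(2.26) pp. 15–17;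
[B9] = CMP **99** (1985) [Balaban1985BackgroundPropagators] (3.87)–(3.90) p. 409, (3.107) p. 416, Thm 3.10 p. 416;
C. King, CMP **102** (1986) [King1986] p. 665.  Nothing here is a claim about the Yang–Mills mass gap.
-/

noncomputable section

namespace Summit.QuantumFields.BalabanUV.T4Continuum.Spine.NE5.TwoRunTorusWalkParametrix

open Matrix Metric Set Finset
open Literature.MathematicalPhysics.QuantumFieldTheory.Balaban1983to89
open Literature.MathematicalPhysics.QuantumFieldTheory.Balaban1983to89.TreeLengthTorus (TPt TDom tsys)
open Literature.MathematicalPhysics.QuantumFieldTheory.Balaban1983to89.TreeLengthTorusTransfer (tclosure)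
open Literature.MathematicalPhysics.QuantumFieldTheory.Balaban1983to89.B13Lemma3TorusData (TBond)
open Literature.MathematicalPhysics.QuantumFieldTheory.Balaban1983to89.B13Lemma3TorusTerms (weight Z0)
open Literature.MathematicalPhysics.QuantumFieldTheory.Balaban1983to89.B13Term214 (core214 F214 term214)
open Literature.MathematicalPhysics.QuantumFieldTheory.Balaban1983to89.B13Bound143 (invTau)
open Literature.MathematicalPhysics.QuantumFieldTheory.Balaban1983to89.B5TorusCover (UT)
open Literature.MathematicalPhysics.QuantumFieldTheory.Balaban1983to89.B13DomainKernelWalks (DomainTerms)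
open Literature.MathematicalPhysics.QuantumFieldTheory.Balaban1983to89.B13CovarianceDifference216
  (differentiableOn_matrix_inv)
open Literature.MathematicalPhysics.QuantumFieldTheory.Balaban1983to89.B13TermWalkData (WalkConsts TermKernels TermWalkData)
open Literature.MathematicalPhysics.QuantumFieldTheory.Balaban1983to89.B13TermWalkDataOneTorus (SmallTheta)
open Literature.MathematicalPhysics.QuantumFieldTheory.Balaban1983to89.B13JointWalkExpansion (WalkMajorants)
open Literature.MathematicalPhysics.QuantumFieldTheory.Balaban1983to89.B13Bound226Located (rowSum_norm_le_of_entrywise)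
open Literature.MathematicalPhysics.QuantumFieldTheory.Balaban1983to89.B13Lemma3TorusPrimitive (kc_tdist1)
open Literature.MathematicalPhysics.QuantumFieldTheory.Balaban1983to89.B11SectG (RowSum)
open Literature.MathematicalPhysics.QuantumFieldTheory.Balaban1983to89.B9Thm34Ext (toB6)
open Literature.MathematicalPhysics.QuantumFieldTheory.Balaban1983to89.B9Thm37GlueTorus (torusGeom tdist1)
open Summit.QuantumFields.BalabanUV.Gaps.D4WalkModelParametrix (ParametrixModelTerm)
open Summit.QuantumFields.BalabanUV.Gaps.D4WalkBlock (blockNorm)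
open Summit.QuantumFields.BalabanUV.Gaps.D4WalkBlockLocal (IsDomainLocalB)
open Summit.QuantumFields.BalabanUV.Gaps.D4WalkBlockParametrix (isDomainLocalB_step)
open Summit.QuantumFields.BalabanUV.Beta.UnitLatticeWalkInversion (Hd)
open Summit.QuantumFields.BalabanUV.T4Continuum.Spine.NE5.TwoRunTorusWalkParam
  (hol_and_h226_torus_of_termWalkData_param)

/-! ## §1. Domain families are entire in σ; glued families are holomorphic in σ where `det(1 − R) ≠ 0` -/

section Sigma

variable {d N' : ℕ} [NeZero N'] {ν : ℕ} {Nf : Fin ν → ℕ} [∀ i, NeZero (Nf i)] {p n : Type}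
variable {E : Type*} [NormedAddCommGroup E] [NormedSpace ℂ E]

/-- **Every entry of a (1.11)∕(3.107)-shape DOMAIN family's term `T_b(σ,u) = (∏_{j ∈ J_b} σ_j)·F_b(u)` is an ENTIRE
function of the decoupling parameters σ** (an `s`-monomial times a σ-independent operator), at every configuration `u`.
[cite: Balaban1988RG2Cluster, (1.11) p.5; Balaban1985BackgroundPropagators, (3.107) p.416] -/
theorem differentiable_domainTerm_sigma (L : DomainTerms d N' ν Nf p n E) (b : L.B) (u : E) (i : p) (j : n) :
    Differentiable ℂ (fun σ : TPt d N' → ℂ => L.term b σ u i j) := by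
  classical
  have h : (fun σ : TPt d N' → ℂ => L.term b σ u i j) = fun σ => (∏ j' ∈ L.J b, σ j') * L.op b u i j :=
    funext fun σ => DomainTerms.term_apply L b σ u i j
  rw [h]
  -- an `s`-monomial is entire (induction on the parameter set)
  have hmono : ∀ J : Finset (TPt d N'), Differentiable ℂ (fun σ : TPt d N' → ℂ => ∏ j' ∈ J, σ j') := by
    intro J
    induction J using Finset.induction_on with
    | empty =>
      have h0 : (fun σ : TPt d N' → ℂ => ∏ j' ∈ (∅ : Finset (TPt d N')), σ j') = fun _ => (1 : ℂ) := by
        funext σ; rw [Finset.prod_empty]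
      rw [h0]
      exact differentiable_const (1 : ℂ)
    | insert a s ha ih =>
      have h1 : (fun σ : TPt d N' → ℂ => ∏ j' ∈ insert a s, σ j') = fun σ => σ a * ∏ j' ∈ s, σ j' := by
        funext σ; rw [Finset.prod_insert ha]
      rw [h1]
      exact Differentiable.fun_mul (E := TPt d N' → ℂ) (𝔸 := ℂ) (differentiable_apply (𝕜 := ℂ) a) ih
  exact Differentiable.fun_mul (E := TPt d N' → ℂ) (𝔸 := ℂ) (hmono (L.J b)) (differentiable_const _)

/-- **Every entry of a (3.107)-shape DOMAIN family's kernel `K(σ,u) = Σ_b T_b(σ,u)` is an ENTIRE function of σ** (a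
polynomial), at every configuration `u`. [cite: Balaban1988RG2Cluster, (1.11) p.5, p.13; Balaban1985BackgroundPropagators, (3.107) p.416] -/
theorem differentiable_domainKernel_sigma (L : DomainTerms d N' ν Nf p n E) (u : E) (i : p) (j : n) :
    Differentiable ℂ (fun σ : TPt d N' → ℂ => L.kernel σ u i j) := by
  have h : (fun σ : TPt d N' → ℂ => L.kernel σ u i j) = fun σ => ∑ b, L.term b σ u i j :=
    funext fun σ => DomainTerms.kernel_apply L σ u i j
  rw [h]
  exact Differentiable.fun_sum (E := TPt d N' → ℂ) (F := ℂ) fun b _ => differentiable_domainTerm_sigma L b u i j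

/-- **The entries of a GLUED family `S(σ)·(1 − R(σ))⁻¹` are holomorphic in σ wherever `S`, `R` have holomorphic entries
and `det(1 − R(σ)) ≠ 0`** ([B9] (3.90): `G = S(1 − R)⁻¹`; the inverse's entries by `A⁻¹ = (det A)⁻¹·adj A`, r10's
`differentiableOn_matrix_inv`). [cite: Balaban1985BackgroundPropagators, (3.90) p.409] -/
theorem differentiableOn_mul_inv_sigma [Fintype n] [DecidableEq n] {P : Type*} [NormedAddCommGroup P] [NormedSpace ℂ P]
    {S2 : P → Matrix p n ℂ} {R2 : P → Matrix n n ℂ} {U : Set P}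
    (hS : ∀ i j, DifferentiableOn ℂ (fun σ => S2 σ i j) U) (hR : ∀ i j, DifferentiableOn ℂ (fun σ => R2 σ i j) U)
    (hdet : ∀ σ ∈ U, ((1 : Matrix n n ℂ) + (-1 : ℂ) • R2 σ).det ≠ 0) (i : p) (j : n) :
    DifferentiableOn ℂ (fun σ => (S2 σ * ((1 : Matrix n n ℂ) + (-1 : ℂ) • R2 σ)⁻¹) i j) U := by
  have h1R : ∀ k l, DifferentiableOn ℂ (fun σ => ((1 : Matrix n n ℂ) + (-1 : ℂ) • R2 σ) k l) U := fun k l => by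
    have h : (fun σ => ((1 : Matrix n n ℂ) + (-1 : ℂ) • R2 σ) k l) = fun σ => (1 : Matrix n n ℂ) k l + (-1 : ℂ) * R2 σ k l :=
      funext fun σ => by simp only [Matrix.add_apply, Matrix.smul_apply, smul_eq_mul]
    rw [h]
    exact (differentiableOn_const _).add ((differentiableOn_const _).mul (hR k l))
  have hinv : ∀ k l, DifferentiableOn ℂ (fun σ => ((1 : Matrix n n ℂ) + (-1 : ℂ) • R2 σ)⁻¹ k l) U :=
    fun k l => differentiableOn_matrix_inv h1R hdet k l
  have h : (fun σ => (S2 σ * ((1 : Matrix n n ℂ) + (-1 : ℂ) • R2 σ)⁻¹) i j) =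
      fun σ => ∑ k, S2 σ i k * ((1 : Matrix n n ℂ) + (-1 : ℂ) • R2 σ)⁻¹ k j :=
    funext fun σ => Matrix.mul_apply
  rw [h]
  exact DifferentiableOn.fun_sum fun k _ => (hS i k).mul (hinv k j)

/-- **σ-HOLOMORPHY OF THE GLUED KERNEL OF TWO DOMAIN FAMILIES**: for (3.107)-shape domain families `S`, `R` and a
configuration `u`, every entry of `(S.kernel σ u·(1 − R.kernel σ u)⁻¹).submatrix f g` is complex differentiable on any
σ-region where `det(1 − R.kernel σ u) ≠ 0` — T25's input (i) for records whose Γ-kernel is a glued family.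
[cite: Balaban1985BackgroundPropagators, (3.87)–(3.90) p.409, (3.107) p.416; Balaban1988RG2Cluster, (1.11) p.5, p.13] -/
theorem differentiableOn_glued_sigma [Fintype n] [DecidableEq n] {q q' : Type}
    (S R : DomainTerms d N' ν Nf n n E) (u : E) (f : q → n) (g : q' → n)
    {U : Set (TPt d N' → ℂ)} (hdet : ∀ σ ∈ U, ((1 : Matrix n n ℂ) + (-1 : ℂ) • R.kernel σ u).det ≠ 0) (i : q) (j : q') :
    DifferentiableOn ℂ
      (fun σ => ((S.kernel σ u * ((1 : Matrix n n ℂ) + (-1 : ℂ) • R.kernel σ u)⁻¹).submatrix f g) i j) U := by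
  simp only [Matrix.submatrix_apply]
  exact differentiableOn_mul_inv_sigma (fun a b => (differentiable_domainKernel_sigma S u a b).differentiableOn)
    (fun a b => (differentiable_domainKernel_sigma R u a b).differentiableOn) hdet (f i) (g j)

end Sigma

/-! ## §2. T25 for records whose Γ-kernel is a glued family: the σ-holomorphy input discharged modulo `det(1 − R) ≠ 0` -/

section Glued

variable {d L N' : ℕ} [NeZero L] [NeZero N'] {M : ℕ}
variable {ν : ℕ} {Nf : Fin ν → ℕ} [∀ i, NeZero (Nf i)]
variable {B : Type*} [NormedAddCommGroup B] [NormedSpace ℂ B]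

open Classical in
/-- **`hPhol` ∧ `h226` FOR ONE TERM FROM A WALK RECORD WHOSE PRECISION IS CONSTANT AND WHOSE Γ-KERNEL IS A GLUED FAMILY**
(T25 with input (i) discharged modulo one located letter).  Data as in T25 `hol_and_h226_torus_of_termWalkData_param` —
ONE record `𝒦 : TermKernels c⁺ d N′ ν Nf B` with `TermWalkData 𝒦 w`, `w.Admissible α Rσ₀`, `0 < α`, NODE A's symmetry ∕
`Re ≻ 0` and `SmallTheta w α θ`, the potentials with (2.20), the common `χ, χᶜ, 𝐃` with (2.22), a column fibre bound,
rates and numerics — EXCEPT that the two σ-holomorphy binders `hAhol hGhol` are REPLACED by the structural datum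
«`𝒦.A2 σ b = A₀` (a σ-independent precision) and `𝒦.G2 σ b = (S.kernel σ b·(1 − R.kernel σ b)⁻¹).submatrix fΛ gN` for two
(3.107)-shape domain families `S`, `R` on a finite site type» ([B9] (3.87)–(3.90) with (3.107)'s decoupling monomials)
plus the located letter `hdet : det(1 − R.kernel σ b) ≠ 0` on the open `e^{κ₁+1}`-polydisc for `b ∈ ball 0 α` (where the
Neumann series (3.90) converges; §4 derives it from a row-sum bound).  NODE O's PARAMETRIX model record
`ParametrixModelTerm.toKernels` has this shape with `A₀ b = 1` (§3, by `rfl`); its walk record is g1-p2's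
`termWalkData_parametrix` (seam, `B = E`) ∕ T18 `TwoRunPencilParametrix.termWalkData_pencil` (NE5's pencil,
`B = E × ℂ`), run at `c⁺`.  Conclusion = T25's.
[cite: Balaban1988RG2Cluster, (1.11) p.5, p.13, (2.14)–(2.16) pp.15–16, (2.20)–(2.26) pp.16–17; Balaban1985BackgroundPropagators, (3.87)–(3.90) p.409, Thm 3.10 p.416; King1986, p.665] -/
theorem hol_and_h226_torus_of_gluedKernels_param (c : B13.Consts) (hκ₁ : 1 ≤ c.κ₁) (hα₆ : c.α₆ ≠ 0)
    (Z : TDom d N') (t : Finset (TDom d (L * N')) × Finset (TBond d M (L * N')))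
    (hpos : ∀ Y : TDom d (L * N'), 0 < invTau c ((tsys d (L * N')).dj Y))
    (hhalf : ∀ Y : TDom d (L * N'), invTau c ((tsys d (L * N')).dj Y) ≤ 1 / 2)
    {Uτ : TDom d (L * N') → Set ℂ} (hUτ : ∀ Y, IsOpen (Uτ Y))
    (hUtau : ∀ Y : TDom d (L * N'), closedBall (0 : ℂ) ((invTau c ((tsys d (L * N')).dj Y))⁻¹) ⊆ Uτ Y)
    {r : ℝ} (hr : 0 < r) (hr' : r ≤ Real.exp c.κ₁ - 1)
    (hsubτ : ∀ Y, ∀ s ∈ Set.uIcc (0 : ℝ) 1, closedBall (s : ℂ) r ⊆ Uτ Y)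
    (lZ : List (TPt d N')) (hlZ : lZ.Nodup ∧ lZ.toFinset = Z.1 \ tclosure L N' (Z0 M t))
    (lD : List (TDom d (L * N'))) (hlD : lD.Nodup ∧ lD.toFinset = t.1)
    -- THE WALK RECORD AT `c⁺` OVER THE PARAMETER SPACE
    (𝒦 : TermKernels ({ c with κ₁ := c.κ₁ + 1 } : B13.Consts) d N' ν Nf B) [Fintype 𝒦.C₀] [DecidableEq 𝒦.C₀]
    {w : WalkConsts} {α Rσ₀ : ℝ} (hw : w.Admissible α Rσ₀) (hα : 0 < α) (h𝒦 : TermWalkData 𝒦 w)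
    -- ITS PRECISION IS σ-INDEPENDENT AND ITS Γ-KERNEL IS A GLUED FAMILY (replaces T25's `hAhol hGhol`)
    {n : Type} [Fintype n] [DecidableEq n] (A₀ : B → Matrix 𝒦.Λ 𝒦.Λ ℂ)
    (S R : DomainTerms d N' ν Nf n n B) (fΛ : 𝒦.Λ → n) (gN : 𝒦.Λ ⊕ 𝒦.C₀ → n)
    (hA2 : ∀ σ b, 𝒦.A2 σ b = A₀ b)
    (hG2 : ∀ σ b, 𝒦.G2 σ b = (S.kernel σ b * ((1 : Matrix n n ℂ) + (-1 : ℂ) • R.kernel σ b)⁻¹).submatrix fΛ gN)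
    (hdet : ∀ b ∈ ball (0 : B) α, ∀ σ : TPt d N' → ℂ, (∀ j, σ j ∈ ball (0 : ℂ) (Real.exp (c.κ₁ + 1))) →
      ((1 : Matrix n n ℂ) + (-1 : ℂ) • R.kernel σ b).det ≠ 0)
    (Γ : B → (TPt d N' → ℂ) → (𝒦.Λ ⊕ 𝒦.C₀ → ℝ) → (𝒦.Λ → ℂ))
    (hlin : ∀ b ∈ ball (0 : B) α, ∀ σ : TPt d N' → ℂ, (∀ j, σ j ∈ ball (0 : ℂ) (Real.exp (c.κ₁ + 1))) →
      ∀ X : 𝒦.Λ ⊕ 𝒦.C₀ → ℝ, Γ b σ X = 𝒦.G2 σ b *ᵥ fun j => (X j : ℂ))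
    (χY₀ χcP : (𝒦.Λ → ℝ) → ℝ) (hχ0 : ∀ Bf, 0 ≤ χY₀ Bf) (hχc0 : ∀ Bf, 0 ≤ χcP Bf) (Dfam : Finset (TDom d (L * N')))
    (Vk : B → TDom d (L * N') → (𝒦.Λ → ℝ) → ℂ)
    -- NOT walk data and NOT structural: the potentials, measurability, NODE A's symmetry ∕ `Re ≻ 0`
    (hVholb : ∀ Y Bf, DifferentiableOn ℂ (fun b => Vk b Y Bf) (ball (0 : B) α))
    (hχm : Measurable χY₀) (hχcm : Measurable χcP) (hVm : ∀ b ∈ ball (0 : B) α, ∀ Y, Measurable (Vk b Y))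
    (hAs : ∀ b : B, ‖b‖ ≤ α → ∀ σ : TPt d N' → ℂ, (∀ j, ‖σ j‖ ≤ Real.exp (c.κ₁ + 1)) → (𝒦.A2 σ b).IsSymm)
    (hA : ∀ b : B, ‖b‖ ≤ α → ∀ σ : TPt d N' → ℂ, (∀ j, ‖σ j‖ ≤ Real.exp (c.κ₁ + 1)) →
      ((𝒦.A2 σ b).map Complex.re).PosDef)
    -- the (2.22) shape, and (2.20) on the open PER-DOMAIN τ-region, uniform in `b`
    {γ₂ rP a₂₀ w₂₀ : ℝ} (qP : (𝒦.Λ → ℝ) → ℝ)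
    (h222 : ∀ Bf, χY₀ Bf * χcP Bf ≤ Real.exp (-(γ₂ / 2 * rP ^ 2 * (t.2.card : ℕ)) + γ₂ / 2 * qP Bf))
    (hγ₂ : 0 ≤ γ₂) (hqP : ∀ Bf, qP Bf ≤ Bf ⬝ᵥ Bf) (ha0 : 0 ≤ a₂₀)
    (h220U : ∀ b ∈ ball (0 : B) α, ∀ τ : TDom d (L * N') → ℂ, (∀ Y, τ Y ∈ Uτ Y) →
      ∀ Bf, ∑ Y ∈ Dfam, ‖τ Y‖ * ‖Vk b Y Bf‖ ≤ a₂₀ / 2 * (Bf ⬝ᵥ Bf) + w₂₀)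
    -- a common fibre bound (rows by the record, columns assumed — located typing point (x10))
    {m : ℕ} (hm : 𝒦.m ≤ m) (hfibN : ∀ x : UT Nf, (Finset.univ.filter fun j => 𝒦.locN j = x).card ≤ m)
    -- rates, NODE A's smallness by name, the remaining numerics in the record's letters
    {κa κb kap' kap'' θ : ℝ} (hκa : κa < w.kap) (hκb : κb < κa) (h2 : kap' < κb) (h1 : kap'' < kap')
    (hkap'' : 0 < kap'') (hsm : SmallTheta w α θ)
    (hθR1le : (m * (1 + 2 / (κb - kap')) ^ ν) * (m * (1 + 2 / (kap' - kap'')) ^ ν)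
      * ((2 * w.KbarΓ * Real.exp (-(w.ε * w.Rσ)) + 2 * w.KbarΓ * α / w.R) * w.KbarC * w.KbarΓ
        + w.KbarΓ * (w.KbarC * (2 * w.KbarE * Real.exp (-(w.ε * w.Rσ)) + 2 * w.KbarE * α / w.R)
            * (𝒦.m * (1 + 2 / (w.kap - κa)) ^ ν) * w.KbarC * (𝒦.m * (1 + 2 / (κa - κb)) ^ ν)) * w.KbarΓ
        + w.KbarΓ * w.KbarC * (2 * w.KbarΓ * Real.exp (-(w.ε * w.Rσ)) + 2 * w.KbarΓ * α / w.R)) ≤ θ)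
    (hsmallKθ : w.KbarC * (m * (1 + 2 / κb) ^ ν) * (θ * (m * (1 + 2 / kap'') ^ ν)) < 1)
    {cE g : ℝ} (hc0 : 0 ≤ cE) (hc : ∀ k, 𝒦.hC.1.eigenvalues k ≤ cE)
    (hαc : (2 * (θ * (m * (1 + 2 / kap'') ^ ν)) + (γ₂ + a₂₀)) * cE ≤ 1 / 2) (hg : 0 ≤ g)
    (hΓq : ∀ X : 𝒦.Λ ⊕ 𝒦.C₀ → ℝ, (𝒦.Γ₀ *ᵥ X) ⬝ᵥ (𝒦.C *ᵥ (𝒦.Γ₀ *ᵥ X)) ≤ g * (X ⬝ᵥ X))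
    (hsmall : (2 * (θ * (m * (1 + 2 / kap'') ^ ν)) + (γ₂ + a₂₀)) * (1 + 2 * cE * g) ≤ 1 / 2)
    {a a₅ : ℝ} (hPa : a ≤ γ₂ * rP ^ 2)
    (hvol : 2 * (w.KbarC * (m * (1 + 2 / κb) ^ ν) * (θ * (m * (1 + 2 / kap'') ^ ν))
              * (1 + (1 - w.KbarC * (m * (1 + 2 / κb) ^ ν) * (θ * (m * (1 + 2 / kap'') ^ ν)))⁻¹) / 2)
          * (Fintype.card 𝒦.Λ : ℝ)
        + w₂₀ + (2 * (θ * (m * (1 + 2 / kap'') ^ ν)) + (γ₂ + a₂₀)) * cE * (Fintype.card 𝒦.Λ : ℝ)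
        + (2 * (θ * (m * (1 + 2 / kap'') ^ ν)) + (γ₂ + a₂₀)) * (1 + 2 * cE * g) * (Fintype.card (𝒦.Λ ⊕ 𝒦.C₀) : ℝ)
        ≤ a₅ * ((Z.1).card : ℝ)) :
    DifferentiableOn ℂ
        (fun b => term214 r lZ lD (core214 (fun σ => 𝒦.A2 σ b) (Γ b) (F214 t.2.card χY₀ χcP Dfam (Vk b))) 0 0)
        (ball (0 : B) α) ∧
      ∀ b ∈ ball (0 : B) α,
        ‖term214 r lZ lD (core214 (fun σ => 𝒦.A2 σ b) (Γ b) (F214 t.2.card χY₀ χcP Dfam (Vk b))) 0 0‖ ≤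
          weight L M c Z a t * Real.exp (a₅ * ((Z.1).card : ℝ)) := by
  -- (i) for the precision: σ-independent, hence entire in σ
  have hAhol : ∀ b ∈ ball (0 : B) α, ∀ i j,
      DifferentiableOn ℂ (fun σ => 𝒦.A2 σ b i j) {σ | ∀ j, σ j ∈ ball (0 : ℂ) (Real.exp (c.κ₁ + 1))} := by
    intro b _ i j
    have h : (fun σ => 𝒦.A2 σ b i j) = fun _ => A₀ b i j := funext fun σ => by rw [hA2]
    rw [h]
    exact differentiableOn_const _
  -- (i) for the Γ-kernel: §1 on the open polydisc, where `det(1 − R) ≠ 0`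
  have hGhol : ∀ b ∈ ball (0 : B) α, ∀ i j,
      DifferentiableOn ℂ (fun σ => 𝒦.G2 σ b i j) {σ | ∀ j, σ j ∈ ball (0 : ℂ) (Real.exp (c.κ₁ + 1))} := by
    intro b hb i j
    have h : (fun σ => 𝒦.G2 σ b i j) =
        fun σ => ((S.kernel σ b * ((1 : Matrix n n ℂ) + (-1 : ℂ) • R.kernel σ b)⁻¹).submatrix fΛ gN) i j :=
      funext fun σ => by rw [hG2]
    rw [h]
    exact differentiableOn_glued_sigma S R b fΛ gN (fun σ hσ => hdet b hb σ hσ) i j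
  exact hol_and_h226_torus_of_termWalkData_param c hκ₁ hα₆ Z t hpos hhalf hUτ hUtau hr hr' hsubτ lZ hlZ lD hlD 𝒦 hw hα
    h𝒦 Γ hlin χY₀ χcP hχ0 hχc0 Dfam Vk hAhol hGhol hVholb hχm hχcm hVm hAs hA qP h222 hγ₂ hqP ha0 h220U hm hfibN hκa
    hκb h2 h1 hkap'' hsm hθR1le hsmallKθ hc0 hc hαc hg hΓq hsmall hPa hvol

end Glued

/-! ## §3. NODE O's parametrix model record has §2's shape, and its NODE-A symmetry ∕ positivity inputs are free -/

section Parametrix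

variable {d N' : ℕ} {ν : ℕ} {Nf : Fin ν → ℕ} [∀ i, NeZero (Nf i)]
variable {B : Type*} [NormedAddCommGroup B] [NormedSpace ℂ B]

/-- **The parametrix model's record has §2's shape** (by `rfl`): precision `A2 σ b = 1`, Γ-kernel
`G2 σ b = (seedT.kernel σ b·(1 − stepT.kernel σ b)⁻¹).submatrix rowOf colOf` — the SEED family `□ ↦ h_□G′_□(b)h_□` and the
STEP family `□ ↦ K(h_□)(b)G′_□(b)h_□` on the term's skeleton ([B9] (3.87)–(3.90)) — so for a parametrix-model term (seam:
g1-p2's `termWalkData_parametrix`; NE5's pencil: T18 `TwoRunPencilParametrix.termWalkData_pencil` on `pencilTerm`, both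
run at `c⁺`) §2 applies with `A₀ = 1`, `S = seedT`, `R = stepT`, `fΛ = rowOf`, `gN = colOf`, and T25's input (i) is gone
modulo `hdet`. [cite: Balaban1985BackgroundPropagators, (3.87)–(3.90) p.409; Balaban1988RG2Cluster, (1.11) p.5, p.15] -/
theorem parametrix_kernels_glued (c' : B13.Consts) (tm : ParametrixModelTerm d N' ν Nf B) :
    (∀ σ b, (tm.toKernels c').A2 σ b = (1 : Matrix tm.Λ tm.Λ ℂ)) ∧
      ∀ σ b, (tm.toKernels c').G2 σ b =
        (tm.seedT.kernel σ b * ((1 : Matrix tm.n tm.n ℂ) + (-1 : ℂ) • tm.stepT.kernel σ b)⁻¹).submatrix tm.rowOf tm.colOf :=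
  ⟨fun _ _ => rfl, fun _ _ => rfl⟩

/-- **For the parametrix model NODE A's symmetry and `Re ≻ 0` inputs of T25 ∕ §2 are FREE**: the precision is `≡ 1`, which
is symmetric with real part `1 ≻ 0` — so for this family the per-term residual (ii) of `HOME/ne/NE5.md` §15 is empty as
well. [cite: Balaban1988RG2Cluster, p.15] -/
theorem parametrix_A2_symm_posDef (c' : B13.Consts) (tm : ParametrixModelTerm d N' ν Nf B) (σ : TPt d N' → ℂ) (b : B) :
    ((tm.toKernels c').A2 σ b).IsSymm ∧ (((tm.toKernels c').A2 σ b).map Complex.re).PosDef := by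
  refine ⟨?_, ?_⟩
  · change (1 : Matrix tm.Λ tm.Λ ℂ).IsSymm
    exact Matrix.isSymm_one
  · change ((1 : Matrix tm.Λ tm.Λ ℂ).map Complex.re).PosDef
    rw [Matrix.map_one Complex.re Complex.zero_re Complex.one_re]
    exact Matrix.PosDef.one

end Parametrix

/-! ## §4. The located letter `det(1 − R) ≠ 0` from an entrywise row-sum bound (Gershgorin) -/

section Det

variable {n : Type} [Fintype n] [DecidableEq n]

/-- **`1 − R` is invertible when every row of `R` has entrywise ℓ¹-mass `< 1`** (strict diagonal dominance ∕ Gershgorin,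
Mathlib `det_ne_zero_of_sum_row_lt_diag`): `Σ_j ‖R i j‖ < 1` for all `i` ⟹ `det(1 − R) ≠ 0`.  This is the located letter
`hdet` of §2 in the currency the step family's walk majorants deliver (a row-sum envelope of `R(σ,b) = Σ_□ (∏σ)K(h_□)G′_□h_□`
on the polydisc × ball — in print the smallness under which the Neumann series (3.90) converges). [cite: Balaban1985BackgroundPropagators, (3.89)–(3.90) p.409] -/
theorem det_one_sub_ne_zero_of_row_lt_one (Rm : Matrix n n ℂ) (h : ∀ i, ∑ j, ‖Rm i j‖ < 1) :
    ((1 : Matrix n n ℂ) + (-1 : ℂ) • Rm).det ≠ 0 := by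
  refine det_ne_zero_of_sum_row_lt_diag fun k => ?_
  have hoff : ∀ j ∈ Finset.univ.erase k, ‖((1 : Matrix n n ℂ) + (-1 : ℂ) • Rm) k j‖ = ‖Rm k j‖ := fun j hj => by
    have hne : k ≠ j := (Finset.ne_of_mem_erase hj).symm
    simp only [Matrix.add_apply, Matrix.one_apply_ne hne, Matrix.smul_apply, smul_eq_mul, zero_add, norm_mul, norm_neg,
      norm_one, one_mul]
  rw [Finset.sum_congr rfl hoff]
  have hdiag : 1 - ‖Rm k k‖ ≤ ‖((1 : Matrix n n ℂ) + (-1 : ℂ) • Rm) k k‖ := by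
    have h1 : ((1 : Matrix n n ℂ) + (-1 : ℂ) • Rm) k k = 1 - Rm k k := by
      simp only [Matrix.add_apply, Matrix.one_apply_eq, Matrix.smul_apply, smul_eq_mul, neg_one_mul, sub_eq_add_neg]
    rw [h1]
    have := norm_sub_norm_le (1 : ℂ) (Rm k k)
    rw [norm_one] at this
    linarith [abs_sub_abs_le_abs_sub ‖(1 : ℂ)‖ ‖Rm k k‖, norm_sub_norm_le (1 : ℂ) (Rm k k)]
  have hsplit : ∑ j ∈ Finset.univ.erase k, ‖Rm k j‖ = ∑ j, ‖Rm k j‖ - ‖Rm k k‖ :=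
    Finset.sum_erase_eq_sub (Finset.mem_univ k)
  rw [hsplit]
  linarith [h k]

/-- **§2's letter `hdet` on the open polydisc × ball from a uniform entrywise row-sum bound of the step family** (the form
in which a producer states it). [cite: Balaban1985BackgroundPropagators, (3.89)–(3.90) p.409] -/
theorem hdet_of_row_lt_one {d N' : ℕ} {ν : ℕ} {Nf : Fin ν → ℕ} [∀ i, NeZero (Nf i)]
    {B : Type*} [NormedAddCommGroup B] [NormedSpace ℂ B] (R : DomainTerms d N' ν Nf n n B) {α ρσ : ℝ}
    (hrow : ∀ b ∈ ball (0 : B) α, ∀ σ : TPt d N' → ℂ, (∀ j, σ j ∈ ball (0 : ℂ) ρσ) → ∀ i, ∑ j, ‖R.kernel σ b i j‖ < 1) :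
    ∀ b ∈ ball (0 : B) α, ∀ σ : TPt d N' → ℂ, (∀ j, σ j ∈ ball (0 : ℂ) ρσ) →
      ((1 : Matrix n n ℂ) + (-1 : ℂ) • R.kernel σ b).det ≠ 0 :=
  fun b hb σ hσ => det_one_sub_ne_zero_of_row_lt_one (R.kernel σ b) (hrow b hb σ hσ)

end Det

/-! ## §5. The letter `hdet` BY NAME from walk majorants of the step family — for the parametrix STEP family from its
primitive letters (the hypotheses of g1-p2's `termWalkData_parametrix`) plus ONE smallness -/

section Majorants

variable {d N' : ℕ} {ν : ℕ} {Nf : Fin ν → ℕ} [∀ i, NeZero (Nf i)] {n : Type} [Fintype n] [DecidableEq n]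
variable {B : Type*} [NormedAddCommGroup B] [NormedSpace ℂ B]

omit [NormedSpace ℂ B] in
/-- **`det(1 − R(σ,u)) ≠ 0` FROM WALK MAJORANTS OF `R`**: a (3.108)-shape `WalkMajorants` family for `R` on the closed
`e^{κ₁}`-polydisc × `R`-ball (constant `K̄`, torus rate `κ > 0`), a column fibre bound `m`, and the smallness
`K̄·m·(1+2∕κ)^ν < 1` ⟹ `det(1 − R(σ,u)) ≠ 0` there — entrywise bound `‖R i j‖ ≤ K̄e^{−κd₁(loc i, loc j)}`
(`WalkMajorants.majorants`), row sums by the torus lattice constant (r10's `rowSum_norm_le_of_entrywise` + `kc_tdist1`), §4.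
[cite: Balaban1985BackgroundPropagators, (3.89)–(3.90) p.409, (3.108) p.416; Balaban1988RG2Cluster, p.16 after (2.19)] -/
theorem det_one_sub_ne_zero_of_walkMajorants {c' : B13.Consts} (locn : n → UT Nf)
    {K2 : (TPt d N' → ℂ) → B → Matrix n n ℂ} {Rb kap Kbar : ℝ} {W : Type}
    {T2 : W → (TPt d N' → ℂ) → B → Matrix n n ℂ} {A : W → ℝ} {D : W → UT Nf → UT Nf → ℝ} {ρ : ℝ}
    (hW : WalkMajorants c' locn locn K2 Rb kap Kbar T2 A D ρ) (hK : 0 ≤ Kbar) (hkap : 0 < kap) {m : ℕ}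
    (hfib : ∀ x : UT Nf, (Finset.univ.filter fun j => locn j = x).card ≤ m)
    (hsmall : Kbar * (m * (1 + 2 / kap) ^ ν) < 1)
    (σ : TPt d N' → ℂ) (hσ : ∀ j, ‖σ j‖ ≤ Real.exp c'.κ₁) (u : B) (hu : u ∈ ball (0 : B) Rb) :
    ((1 : Matrix n n ℂ) + (-1 : ℂ) • K2 σ u).det ≠ 0 := by
  refine det_one_sub_ne_zero_of_row_lt_one (K2 σ u) fun i => lt_of_le_of_lt ?_ hsmall
  exact rowSum_norm_le_of_entrywise kc_tdist1 hK hkap locn locn hfib (fun i j => hW.majorants σ hσ u hu i j) i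

/-- **THE LETTER `hdet` FOR NODE O's PARAMETRIX STEP FAMILY FROM ITS PRIMITIVE LETTERS** — under the skeleton ∕ partition ∕
local-inverse ∕ commutator hypotheses of g1-p2's `D4WalkModelParametrix.termWalkData_parametrix` (anchors, diameter `r`,
`|J| ≤ m_J`, σ-terms meet `X`, multiplicity `n_D`, `#dom ≤ n_C`; `|h| ≤ 1` with supports inside the domains; `G′_□` holomorphic
with block bound `C_L`; `K′` holomorphic with commutator block bound `λ_K` and blocks inside the domains), a window
`κ + μ ≤ ρ` with (2.61) at rate `μ` (constant `c_μ`), a column fibre bound `m` for the sites, and ONE smallness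
`K̄_R·m·(1+2∕κ)^ν < 1` with `K̄_R = (n_Cλ_KC_L)e^{κ₁′m_J}e^{2ρr}e^{μr}n_Dc_μ` (print: `λ_K = O(M⁻¹)` small, [B9] (3.89)):
`det(1 − R(σ,u)) ≠ 0` for the STEP family `R = stepT` on the closed `e^{κ₁′}`-polydisc × `R`-ball (at `c⁺` this covers §2's
open region).  Chain: g1-p2's `isDomainLocalB_step` → `.toFlat` → `DomainTerms.walkMajorants_domainLocal` → previous theorem.
[cite: Balaban1985BackgroundPropagators, (3.87)–(3.90) p.409, Cor 3.8 p.410, (3.107)–(3.108) p.416; Balaban1984PropagatorsII, (2.61) p.234; Balaban1988RG2Cluster, (1.11) p.5, p.13] -/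
theorem hdet_parametrix_step (c' : B13.Consts) (hκ₁ : 0 ≤ c'.κ₁) (tm : ParametrixModelTerm d N' ν Nf B)
    {R CL lamK r : ℝ} {mJ nD nC : ℕ} {ρ kap μ cμ : ℝ}
    (hanchor : ∀ b, tm.L.anchor b ∈ tm.L.dom b) (hdiam : ∀ b, ∀ z ∈ tm.L.dom b, ∀ z' ∈ tm.L.dom b, tdist1 Nf z z' ≤ r)
    (hJ : ∀ b, (tm.L.J b).card ≤ mJ) (hX : ∀ b, (tm.L.J b).Nonempty → (tm.L.dom b ∩ tm.X).Nonempty)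
    (hmult : ∀ z : UT Nf, (Finset.univ.filter fun b => tm.L.anchor b = z).card ≤ nD)
    (hsupp : ∀ b y, y ∉ tm.Es b → tm.h b y = 0) (habs : ∀ b y, |tm.h b y| ≤ 1)
    (hE : ∀ b y, y ∈ tm.Es b → tm.cubn y ∈ tm.L.dom b)
    (hLan : ∀ b i j, DifferentiableOn ℂ (fun u => tm.L.op b u i j) (ball (0 : B) R))
    (hLbd : ∀ b, ∀ u ∈ ball (0 : B) R, ∀ y y', blockNorm tm.cubn tm.cubn (tm.L.op b u) y y' ≤ CL) (hCL : 0 ≤ CL)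
    (hKan : ∀ i j, DifferentiableOn ℂ (fun u => tm.K' u i j) (ball (0 : B) R))
    (hKbd : ∀ b, ∀ u ∈ ball (0 : B) R, ∀ y y',
      blockNorm tm.cubn tm.cubn (Hd tm.h b * tm.K' u - tm.K' u * Hd tm.h b) y y' ≤ lamK) (hlamK : 0 ≤ lamK)
    (hKsupp : ∀ b u y y', blockNorm tm.cubn tm.cubn (Hd tm.h b * tm.K' u - tm.K' u * Hd tm.h b) y y' ≠ 0 →
      y ∈ tm.L.dom b ∧ y' ∈ tm.L.dom b)
    (hcard : ∀ b, (tm.L.dom b).card ≤ nC)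
    (hρ : 0 ≤ ρ) (hkap : 0 < kap) (hμ : 0 ≤ μ) (hwin : kap + μ ≤ ρ)
    (hrow : RowSum (toB6 (torusGeom Nf 0 0 0) 0 True) μ cμ) (hcμ : 0 ≤ cμ)
    {m : ℕ} (hfib : ∀ x : UT Nf, (Finset.univ.filter fun j => tm.cubn j = x).card ≤ m)
    (hsmall : (((nC : ℝ) * lamK * CL) * Real.exp (c'.κ₁ * mJ) * Real.exp (2 * ρ * r) * Real.exp (μ * r) * ((nD : ℝ) * cμ))
      * (m * (1 + 2 / kap) ^ ν) < 1) :
    ∀ σ : TPt d N' → ℂ, (∀ j, ‖σ j‖ ≤ Real.exp c'.κ₁) → ∀ u ∈ ball (0 : B) R,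
      ((1 : Matrix tm.n tm.n ℂ) + (-1 : ℂ) • tm.stepT.kernel σ u).det ≠ 0 := by
  have hB : IsDomainLocalB tm.stepT c' tm.cubn tm.cubn tm.X R (nC * lamK * CL) r mJ nD :=
    isDomainLocalB_step (c := c') hanchor hdiam hJ hX hmult hsupp habs hE hLan hLbd hCL hKan hKbd hlamK hKsupp hcard
  have hW := DomainTerms.walkMajorants_domainLocal hB.toFlat hκ₁ (by positivity) hρ hkap.le hμ hwin hrow
  intro σ hσ u hu
  exact det_one_sub_ne_zero_of_walkMajorants tm.cubn hW (by positivity) hkap hfib hsmall σ hσ u hu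

end Majorants

end Summit.QuantumFields.BalabanUV.T4Continuum.Spine.NE5.TwoRunTorusWalkParametrix

end
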